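import Mathlib.Topology.Order.IntermediateValue
import Mathlib.Topology.MetricSpace.Pseudo.Lemmas
import Mathlib.Topology.Instances.Real.Lemmas
import Mathlib.Tactic.Linarith

/-!
# The continuity (bootstrap) principle on `[0,1]`

Helper for crux stmt-CriticalPhenomena-7029
(`Summit.CriticalPhenomena.CardyFormulaZ2.Theses.CardyFlipRusso.QuadrupoleSelectionRule`),
line Sketch, stub S5: the continuity-method skeleton of card B `leg-continuity-robust-gap`.

A continuous "defect" `u` on `[0,1]` starts below `ε` at `t = 0`; as long as it stays strictly
below a threshold `η` on `[0,t]`, a robust-gap estimate improves the bound to `u s ≤ ε + ε' * s`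
on `[0,t]`.  Since `ε + ε' < η`, the improved bound never reaches the threshold, so it
propagates to the whole interval ("continuous induction").

The proof runs Mathlib's continuous induction principle
`IsClosed.Icc_subset_of_forall_mem_nhdsGT_of_Icc_subset` on the closed set
`{x | u x ≤ ε + ε' * x}`: if the improved bound holds on `[0,t]` with `t < 1`, then `u < η`
there, hence (by continuity of `u` at `t`) on a slightly larger interval `[0,t']`, and the
bootstrap hypothesis gives the improved bound at every such `t'`.
-/

namespace Summit.CriticalPhenomena.CardyFormulaZ2.Theorems

open Set Filter Topology

/-- **Bootstrap (continuity) principle on `[0,1]`.**  Let `u` be continuous on `[0,1]` with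
`u 0 ≤ ε`, let `0 ≤ ε'` and `ε + ε' < η`.  Suppose that for every `t ∈ [0,1]`, if `u < η` on
`[0,t]` then `u s ≤ ε + ε' * s` for all `s ∈ [0,t]`.  Then `u t ≤ ε + ε' * t` for every
`t ∈ [0,1]`. [folklore] -/
theorem bootstrap_principle (u : ℝ → ℝ) (ε ε' η : ℝ) (hu : ContinuousOn u (Set.Icc 0 1))
    (hε' : 0 ≤ ε') (h0 : u 0 ≤ ε) (hgap : ε + ε' < η)
    (hboot : ∀ t ∈ Set.Icc (0 : ℝ) 1, (∀ s ∈ Set.Icc (0 : ℝ) t, u s < η) →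
      ∀ s ∈ Set.Icc (0 : ℝ) t, u s ≤ ε + ε' * s) :
    ∀ t ∈ Set.Icc (0 : ℝ) 1, u t ≤ ε + ε' * t := by
  -- The induction set: points where the improved bound holds.
  set S : Set ℝ := {x | u x ≤ ε + ε' * x} with hS_def
  suffices h : Icc (0 : ℝ) 1 ⊆ S from fun t ht => h ht
  -- `S ∩ [0,1]` is closed, by continuity of `u` on the closed interval.
  have hclosed : IsClosed (S ∩ Icc (0 : ℝ) 1) := by
    have hEq : S ∩ Icc (0 : ℝ) 1 = {x ∈ Icc (0 : ℝ) 1 | u x ≤ ε + ε' * x} := by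
      ext x
      simp only [hS_def, mem_inter_iff, mem_setOf_eq]
      exact and_comm
    rw [hEq]
    exact isClosed_Icc.isClosed_le hu (by fun_prop)
  have h0S : (0 : ℝ) ∈ S := by
    show u 0 ≤ ε + ε' * 0
    simpa using h0
  refine hclosed.Icc_subset_of_forall_mem_nhdsGT_of_Icc_subset h0S ?_
  intro t ht hsub
  -- On `[0,t]` the improved bound holds, hence `u < η` there (as `t < 1` and `0 ≤ ε'`).
  have hlt : ∀ x ∈ Icc (0 : ℝ) t, u x < η := by
    intro x hx
    have h1 : u x ≤ ε + ε' * x := hsub hx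
    have h2 : ε' * x ≤ ε' := by
      have hx1 : x ≤ 1 := hx.2.trans ht.2.le
      simpa using mul_le_mul_of_nonneg_left hx1 hε'
    linarith
  -- By continuity at `t` within `[0,1]`, `u < η` persists slightly to the right of `t`.
  have hct : ContinuousWithinAt u (Icc (0 : ℝ) 1) t := hu t ⟨ht.1, ht.2.le⟩
  have hev : ∀ᶠ x in 𝓝[Icc (0 : ℝ) 1] t, u x < η :=
    hct.tendsto.eventually_lt_const (hlt t ⟨ht.1, le_rfl⟩)
  rw [eventually_nhdsWithin_iff, Metric.eventually_nhds_iff] at hev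
  obtain ⟨δ, hδ, hδ'⟩ := hev
  -- Hence every `t' ∈ (t, min (t + δ) 1)` satisfies the bootstrap premise on `[0,t']`.
  rw [mem_nhdsGT_iff_exists_Ioo_subset]
  refine ⟨min (t + δ) 1, lt_min (by linarith) ht.2, ?_⟩
  intro t' ht'
  have ht'1 : t' < 1 := ht'.2.trans_le (min_le_right _ _)
  have ht'δ : t' < t + δ := ht'.2.trans_le (min_le_left _ _)
  have ht'mem : t' ∈ Icc (0 : ℝ) 1 := ⟨ht.1.trans ht'.1.le, ht'1.le⟩
  have key : ∀ s ∈ Icc (0 : ℝ) t', u s < η := by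
    intro s hs
    rcases le_or_gt s t with hst | hst
    · exact hlt s ⟨hs.1, hst⟩
    · refine hδ' ?_ ⟨hs.1, hs.2.trans ht'1.le⟩
      rw [Real.dist_eq, abs_lt]
      constructor <;> linarith [hs.2]
  exact hboot t' ht'mem key t' ⟨ht'mem.1, le_rfl⟩

end Summit.CriticalPhenomena.CardyFormulaZ2.Theorems
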